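import Mathlib
import Literature.Topology.PlaneTopology.WindingNumber
import HarnessLib

/-!
# Zeros persist: non-zero winding number on a circle forces zeros inside

A Rouché–Brouwer type consequence of the winding number
(`Literature.Topology.PlaneTopology.wind`): let `c : ℂ → ℂ` be continuous on the circle
`‖z - ζ‖ = ε` with non-zero winding number along it, and let `d` be continuous on the closed disc
`‖z - ζ‖ ≤ ε` with `‖d - c‖ < ‖c‖` pointwise on the circle. Then `d` vanishes somewhere in the
closed disc (`exists_zero_of_norm_sub_lt_on_sphere`): by Rouché for loops
(`wind_eq_of_norm_sub_lt`) `d ∘ γ` winds like `c ∘ γ`, whereas a zero-free `d` would have a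
continuous logarithm on the (star-shaped) closed disc (`hasLogOn_closedBall`, homotopy lifting)
and hence winding number `0`. In particular zeros persist under uniform convergence on the circle
(`eventually_exists_zero_of_tendstoUniformlyOn`) — the form in which isolated intersections of
positive index of `J`-holomorphic curves survive `C⁰`-small perturbations (McDuff 1991 §4;
McDuff–Salamon 2012, App. E).

Provenance: first written for the crux `TameOrBrodyR4` of summit `SmoothPoincare4`
(`Theorems/SullivanDualTameOrBrodyR4HelperZerosPersist.lean`), re-homed here (promotion event
3639839) with the non-asymptotic form added; step W4 of the Literature proof of
`Literature.Geometry.Symplectic.jHolomorphicLimitOfEmbedded_isEmbedded`.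
-/

noncomputable section

open Filter Set Metric
open scoped Topology

namespace Literature.Topology.PlaneTopology

/-- A continuous zero-free map on a closed disc has a continuous logarithm there (radial homotopy
to the constant value at the centre, and homotopy lifting). [folklore] -/
theorem hasLogOn_closedBall {g : ℂ → ℂ} {a : ℂ} {r : ℝ} (hg : ContinuousOn g (closedBall a r))
    (hne : ∀ z ∈ closedBall a r, g z ≠ 0) : HasLogOn g (closedBall a r) := by
  rcases lt_or_ge r 0 with hr | hr
  · rw [closedBall_eq_empty.2 hr]
    exact hasLogOn_empty g
  have hmem : ∀ t ∈ Icc (0 : ℝ) 1, ∀ z ∈ closedBall a r,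
      a + (t : ℂ) * (z - a) ∈ closedBall a r := by
    intro t ht z hz
    rw [mem_closedBall_iff_norm] at hz ⊢
    rw [add_sub_cancel_left, norm_mul, Complex.norm_of_nonneg ht.1]
    nlinarith [ht.1, ht.2, norm_nonneg (z - a)]
  have hmaps : MapsTo (fun p : ℝ × ℂ => a + (p.1 : ℂ) * (p.2 - a)) (Icc 0 1 ×ˢ closedBall a r)
      (closedBall a r) := fun p hp => hmem p.1 hp.1 p.2 hp.2
  have hcont : ContinuousOn (fun p : ℝ × ℂ => g (a + (p.1 : ℂ) * (p.2 - a)))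
      (Icc 0 1 ×ˢ closedBall a r) := hg.comp (by fun_prop) hmaps
  exact HasLogOn.of_homotopy (f := fun _ => g a) (fun t z => g (a + (t : ℂ) * (z - a))) hcont
    (fun z _ => by simp) (fun z _ => by simp) (fun t ht z hz => hne _ (hmem t ht z hz))
    (hasLogOn_const (hne a (mem_closedBall_self hr)) _)

/-- **Zeros persist (Rouché–Brouwer form).** Let `c` be continuous on the circle `‖z - ζ‖ = ε`
(`ε > 0`) with `wind (c ∘ circleLoop ζ ε) ≠ 0`, and let `d` be continuous on the closed disc
`‖z - ζ‖ ≤ ε` with `‖d z - c z‖ < ‖c z‖` on the circle. Then `d` has a zero in the closed disc.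
[folklore] -/
theorem exists_zero_of_norm_sub_lt_on_sphere {c d : ℂ → ℂ} {ζ : ℂ} {ε : ℝ} (hε : 0 < ε)
    (hc : ContinuousOn c (sphere ζ ε))
    (hwind : wind (fun t => c (circleLoop ζ ε t)) ≠ 0)
    (hd : ContinuousOn d (closedBall ζ ε))
    (hclose : ∀ z ∈ sphere ζ ε, ‖d z - c z‖ < ‖c z‖) :
    ∃ z ∈ closedBall ζ ε, d z = 0 := by
  -- the circle loop `γ` lies on the circle, hence in the closed disc
  have hγs : ∀ t, circleLoop ζ ε t ∈ sphere ζ ε := fun t => circleLoop_mem_sphere ζ hε.le t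
  have hγb : ∀ t, circleLoop ζ ε t ∈ closedBall ζ ε := fun t =>
    sphere_subset_closedBall (hγs t)
  have hcne : ∀ z ∈ sphere ζ ε, c z ≠ 0 := fun z hz h0 => by
    have := hclose z hz
    rw [h0, sub_zero, norm_zero] at this
    exact (norm_nonneg _).not_gt this
  -- Rouché for loops: `wind (d ∘ γ) = wind (c ∘ γ)`
  have hg : IsNonvanishingLoop (fun t => c (circleLoop ζ ε t)) :=
    ⟨hc.comp (continuous_circleLoop ζ ε).continuousOn fun t _ => hγs t,
      fun t _ => hcne _ (hγs t), by rw [circleLoop_zero_eq]⟩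
  have hf : ContinuousOn (fun t => d (circleLoop ζ ε t)) (Icc 0 1) :=
    hd.comp (continuous_circleLoop ζ ε).continuousOn fun t _ => hγb t
  have hwn : wind (fun t => d (circleLoop ζ ε t)) = wind (fun t => c (circleLoop ζ ε t)) :=
    wind_eq_of_norm_sub_lt hf (by rw [circleLoop_zero_eq]) hg fun t _ => hclose _ (hγs t)
  -- no zero in the closed disc ⇒ a logarithm there ⇒ winding number zero: contradiction
  by_contra h
  push Not at h
  have hlog : HasLogOn d (closedBall ζ ε) := hasLogOn_closedBall hd h
  have h0 : wind (fun t => d (circleLoop ζ ε t)) = 0 :=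
    wind_comp_eq_zero_of_hasLogOn hlog (continuous_circleLoop ζ ε).continuousOn
      (fun t _ => hγb t) (circleLoop_zero_eq ζ ε)
  exact hwind (hwn.symm.trans h0)

/-- **Zeros persist under uniform convergence on a circle.** If `c` is continuous and zero-free on
the circle `‖z - ζ‖ = ε` with non-zero winding number, and `d n → c` uniformly on the circle with
each `d n` continuous on the closed disc, then eventually every `d n` vanishes somewhere in the
closed disc. [folklore] -/
theorem eventually_exists_zero_of_tendstoUniformlyOn {c : ℂ → ℂ} {d : ℕ → ℂ → ℂ} {ζ : ℂ}
    {ε : ℝ} (hε : 0 < ε) (hc : ContinuousOn c (sphere ζ ε)) (hcne : ∀ z ∈ sphere ζ ε, c z ≠ 0)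
    (hwind : wind (fun t => c (circleLoop ζ ε t)) ≠ 0)
    (hd : ∀ n, ContinuousOn (d n) (closedBall ζ ε))
    (hconv : TendstoUniformlyOn d c atTop (sphere ζ ε)) :
    ∀ᶠ n in atTop, ∃ z ∈ closedBall ζ ε, d n z = 0 := by
  -- a positive lower bound of `‖c‖` on the compact circle
  have hsph_ne : (sphere ζ ε).Nonempty := ⟨circleLoop ζ ε 0, circleLoop_mem_sphere ζ hε.le 0⟩
  obtain ⟨z₀, hz₀, hmin⟩ := (isCompact_sphere ζ ε).exists_isMinOn hsph_ne hc.norm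
  have hm0 : 0 < ‖c z₀‖ := norm_pos_iff.2 (hcne z₀ hz₀)
  -- eventually `d n` is uniformly `min ‖c‖`-close to `c` on the circle
  have hev : ∀ᶠ n in atTop, ∀ z ∈ sphere ζ ε, dist (c z) (d n z) < ‖c z₀‖ :=
    Metric.tendstoUniformlyOn_iff.1 hconv _ hm0
  refine hev.mono fun n hn => exists_zero_of_norm_sub_lt_on_sphere hε hc hwind (hd n) ?_
  intro z hz
  calc ‖d n z - c z‖ = dist (c z) (d n z) := by rw [dist_comm, dist_eq_norm]
    _ < ‖c z₀‖ := hn z hz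
    _ ≤ ‖c z‖ := isMinOn_iff.1 hmin z hz

end Literature.Topology.PlaneTopology

end
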